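import Literature.NumberTheory.ComplexMultiplication.EllipticUnits.DeShalitDivisionPointsLattice
import Literature.NumberTheory.NumberFields.RayClassFieldLocalTowerContainment
import HarnessLib

/-!
# Readings of division points: the MODEL coordinates `x(ξ(z)) = ℘(z) − b₂/12`, `y(ξ(z)) = (℘′(z) − a₁x − a₃)/2` of a
# `𝔠`-division point of a CM lattice as elements of `K̄` (de Shalit II.1.5 (15): they lie in `K(𝔣ψ𝔠)`), and their images in the
# local tower `E·K_π^{n+1}` at a split prime `v` (II.1.10, II.4.3–4.5)

Topic `NumberTheory/EllipticCurves` (theorems only; no definition, no named fact, no instance, no `sorry`).  Cell `bsd-print-cf2`,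
width seat `bsd-line-cf2c-w4` g16, piece (RD) «READINGS» of the j = 0 seam: the binder block
`xu yu xq yq xw yw xz yz / XU YU XQ YQ XW YW XZ YZ` (with its sixteen reading equations) of
`Summits/…/Theorems/PrintCf2RubinValueTwoKatzMeasureJZeroSeamPerUnitBridge.lean` (B10f-b/c/d) and the reading families of
`DivisionPointsKernelMembership` ((N1)-PKG), DISCHARGED from

* clause (vi) of the fifth print `DeShalit1987.prop15_grossencharacterReciprocity` (II.1.5 (15): for `z ∈ 𝔠⁻¹L ∖ L` there are
  `x, y ∈ K(𝔣ψ𝔠)` with `ι̂ x = ℘_L(z)`, `ι̂ y = ℘′_L(z)`), taken here AS A HYPOTHESIS `h6` with the print's `∃`-bound conductor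
  ideal `𝔣ψ` as a binder (the caller obtains it once from the print);
* the model lattice `L = Ω·ι(𝔪)` of `ThetaValueOneModelLattice` / `DeShalitDivisionPointsLattice` (memberships `z ∈ (𝔪v^k)⁻¹L` of
  de Shalit's `u_k = β^kΩ − Ω/π₀^k`, `Ω/π₀^k`, `Ω + u_k`, `π₀(Ω + u_k)` — §3 — and their non-membership in `L`, B-lat §5);
* `RayClassFieldLocalTowerContainment.absClosureEmbedding_mem_sup_ltField_of_mem_rayClassField_mul_pow` (II.1.10: `e(K(𝔑v^{n+1})) ⊆ E·K_π^{n+1}`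
  for a READING MODULUS `𝔑`, `v ∤ 𝔑`, with its `α`-datum `α ≡ 1 (𝔑)`, `(α) = v^f`, `α = π^f` and `f ∣ deg` on `E`).

READING MODULUS.  Since the coordinates of the `𝔠`-division points lie in `K(𝔣ψ·𝔠)` and NOT in `K(𝔠)`, the local field must read
`K(𝔣ψ·𝔪·v^{n+1})`: every theorem below is stated for a caller-chosen modulus `𝔑` with `𝔑 ≤ 𝔣ψ * 𝔪` (`𝔣ψ𝔪 ∣ 𝔑`), `v ∤ 𝔑`, and an
unramified base `E` satisfying the `α`-datum of `𝔑` — for the seam this means an `E` containing `e(K(𝔣ψ·𝔣_k))`, larger than the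
`E k` of the (e)-assembly's frame (come back with `LubinTateColemanRelativeBaseChangeTwo.relColemanSeries_baseChange`).

* §1 `algClosureEmb_modelX` / `algClosureEmb_modelY` / `modelX_mem` / `modelY_mem` — the change of variables `(℘, ℘′) ↦ (x, y)` of the
  integral model `W/ℤ` inside `K̄`, and ★ `exists_model_coords_mem_rayClassField` (`x, y ∈ K(𝔣ψ𝔠)` in MODEL coordinates);
* §2 `absClosureEmbedding_mem_sup_ltField_of_le` (`e(K(𝔐)) ⊆ E·K_π^{n+1}` whenever `𝔑v^{n+1} ≤ 𝔐`) and ★★ `exists_reading`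
  (one `z ∈ 𝔠⁻¹L ∖ L`, `𝔑·v^{n+1} ≤ 𝔣ψ·𝔠`: `∃ x y : K̄, ∃ X Y ∈ E·K_π^{n+1}` with the two reading equations and `↑X = e x`, `↑Y = e y`);
* §3 memberships `mem_idealInvLattice_mul_pow_of_eq` (`ι(π₀^k)·z ∈ Ω·ι(𝒪_K) ⇒ z ∈ (𝔪v^k)⁻¹L`) and the four families
  `divisionPt_mem_idealInvLattice` (`u_k`), `div_mem_idealInvLattice` (`Ω/ι(π₀^k)`), `add_divisionPt_mem_idealInvLattice` (`Ω + u_k`),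
  `mul_add_divisionPt_mem_idealInvLattice` (`ι(π₀)(Ω + u_k)`), `div_pow_notMem` (`Ω/ι(π₀^k) ∉ L`);
* §4 ★★★ `exists_divisionPt_readings` — THE SIXTEEN-OBJECT BLOCK of B10f-b VERBATIM (`xu … yz : ℕ → K̄`, `XU YU XQ YQ : ∀ m, E·K_π^{m+1}`,
  `XW YW XZ YZ : ∀ m, E·K_π^{m+2}`, sixteen equations), as one `∃`;
* sequel `DivisionPointReadingsAtLevel`: reading families (any index type) and the sixteen-object block of (N1)-PKG
  (`DivisionPointsKernelMembership.some_mem_kernel_divisionPt_of_readings`) at one level.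

No summit statement is proved; BSD is not proved by any of this.

## References
* [deShalit1987] E. de Shalit, *Iwasawa theory of elliptic curves with complex multiplication* (1987), II §1.5 (15) (p. 42),
  II §1.10 Lemma (p. 39), II §4.3–4.5 (p. 57–58), II §4.4 (iv), II §4.9 (23) (p. 62–63).
* [SilvermanAEC2009] J. H. Silverman, *The Arithmetic of Elliptic Curves*, 2nd ed. (2009), III.1 (change of variables), VI.3.6 (b).
-/

noncomputable section

open scoped Classical NumberField
open NumberField IsDedekindDomain IsDedekindDomain.HeightOneSpectrum Field PeriodPair
open Literature.NumberTheory.NumberFields Literature.NumberTheory.GaloisRepresentations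
  Literature.NumberTheory.GaloisRepresentations.IsNonarchimedeanLocalField Literature.NumberTheory.GaloisRepresentations.LubinTate
  Literature.NumberTheory.ComplexMultiplication.EllipticUnits

namespace Literature.NumberTheory.EllipticCurves

namespace DivisionPointReadings

variable {K : Type} [Field K] [NumberField K] (ι : K →+* ℂ) (L : PeriodPair) (W : WeierstrassCurve ℤ)

/-! ## §1 Model coordinates inside `K̄` -/

/-- `b₂(W ⊗ ℂ) = b₂(W)` read in `ℂ`. [cite: SilvermanAEC2009, III.1] -/
theorem baseChange_b₂ : (W.baseChange ℂ).b₂ = (W.b₂ : ℂ) := by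
  simp [WeierstrassCurve.baseChange, WeierstrassCurve.map_b₂]

/-- `a₁(W ⊗ ℂ) = a₁(W)`. [cite: SilvermanAEC2009, III.1] -/
theorem baseChange_a₁ : (W.baseChange ℂ).a₁ = (W.a₁ : ℂ) := by
  simp [WeierstrassCurve.baseChange]

/-- `a₃(W ⊗ ℂ) = a₃(W)`. [cite: SilvermanAEC2009, III.1] -/
theorem baseChange_a₃ : (W.baseChange ℂ).a₃ = (W.a₃ : ℂ) := by
  simp [WeierstrassCurve.baseChange]

/-- `ι̂ (x − b₂/12) = ι̂ x − b₂/12`: the model `x`-coordinate descends along `ι̂ : K̄ → ℂ`. [cite: SilvermanAEC2009, III.1] -/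
theorem algClosureEmb_modelX (x : AlgebraicClosure K) :
    algClosureEmb ι (x - (W.b₂ : AlgebraicClosure K) / 12) = algClosureEmb ι x - (W.baseChange ℂ).b₂ / 12 := by
  rw [baseChange_b₂, map_sub, map_div₀, map_intCast, map_ofNat]

/-- `ι̂ ((y − a₁(x − b₂/12) − a₃)/2) = (ι̂ y − a₁(ι̂ x − b₂/12) − a₃)/2`: the model `y`-coordinate descends along `ι̂`.
[cite: SilvermanAEC2009, III.1] -/
theorem algClosureEmb_modelY (x y : AlgebraicClosure K) :
    algClosureEmb ι ((y - (W.a₁ : AlgebraicClosure K) * (x - (W.b₂ : AlgebraicClosure K) / 12) - (W.a₃ : AlgebraicClosure K)) / 2) =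
      (algClosureEmb ι y - (W.baseChange ℂ).a₁ * (algClosureEmb ι x - (W.baseChange ℂ).b₂ / 12) - (W.baseChange ℂ).a₃) / 2 := by
  rw [map_div₀, map_sub, map_sub, map_mul, algClosureEmb_modelX, map_intCast, map_intCast, map_ofNat, baseChange_a₁, baseChange_a₃]

omit [NumberField K] in
/-- The model `x`-coordinate stays in any intermediate field containing `x`. [cite: SilvermanAEC2009, III.1] -/
theorem modelX_mem {F : IntermediateField K (AlgebraicClosure K)} {x : AlgebraicClosure K} (hx : x ∈ F) :
    x - (W.b₂ : AlgebraicClosure K) / 12 ∈ F :=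
  sub_mem hx (div_mem (intCast_mem F _) (ofNat_mem F 12))

omit [NumberField K] in
/-- The model `y`-coordinate stays in any intermediate field containing `x` and `y`. [cite: SilvermanAEC2009, III.1] -/
theorem modelY_mem {F : IntermediateField K (AlgebraicClosure K)} {x y : AlgebraicClosure K} (hx : x ∈ F) (hy : y ∈ F) :
    (y - (W.a₁ : AlgebraicClosure K) * (x - (W.b₂ : AlgebraicClosure K) / 12) - (W.a₃ : AlgebraicClosure K)) / 2 ∈ F :=
  div_mem (sub_mem (sub_mem hy (mul_mem (intCast_mem F _) (modelX_mem W hx))) (intCast_mem F _)) (ofNat_mem F 2)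

variable {𝔣ψ : Ideal (𝓞 K)}

/-- ★ **The MODEL coordinates of a `𝔠`-division point lie in `K(𝔣ψ𝔠)`** (de Shalit II.1.5 (15), read through the change of variables
to the integral model `W/ℤ`: `x = ℘(z) − b₂/12`, `y = (℘′(z) − a₁x − a₃)/2`), from clause (vi) of the fifth print taken as the
hypothesis `h6`. [cite: deShalit1987, II §1.5 (15) (p. 42)] [cite: SilvermanAEC2009, III.1] -/
theorem exists_model_coords_mem_rayClassField
    (h6 : ∀ 𝔠 : Ideal (𝓞 K), 𝔠 ≠ ⊥ → ∀ z : ℂ, z ∈ idealInvLattice ι 𝔠 L.lattice → z ∉ L.lattice →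
      ∃ x y : rayClassField K (𝔣ψ * 𝔠), algClosureEmb ι x = ℘[L] z ∧ algClosureEmb ι y = ℘'[L] z)
    {𝔠 : Ideal (𝓞 K)} (h𝔠 : 𝔠 ≠ ⊥) {z : ℂ} (hz : z ∈ idealInvLattice ι 𝔠 L.lattice) (hzL : z ∉ L.lattice) :
    ∃ x y : AlgebraicClosure K, x ∈ rayClassField K (𝔣ψ * 𝔠) ∧ y ∈ rayClassField K (𝔣ψ * 𝔠) ∧
      algClosureEmb ι x = ℘[L] z - (W.baseChange ℂ).b₂ / 12 ∧
      algClosureEmb ι y = (℘'[L] z - (W.baseChange ℂ).a₁ * (℘[L] z - (W.baseChange ℂ).b₂ / 12) - (W.baseChange ℂ).a₃) / 2 := by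
  obtain ⟨x, y, hx, hy⟩ := h6 𝔠 h𝔠 z hz hzL
  exact ⟨_, _, modelX_mem W x.2, modelY_mem W x.2 y.2, by rw [algClosureEmb_modelX, hx], by rw [algClosureEmb_modelY, hx, hy]⟩

/-! ## §2 Reading into the local tower `E·K_π^{n+1}` -/

variable [IsTotallyComplex K] {v : HeightOneSpectrum (𝓞 K)} {𝔑 : Ideal (𝓞 K)}

open ValuativeRel in
/-- **`e(K(𝔐)) ⊆ E·K_π^{n+1}` whenever `𝔑·v^{n+1} ≤ 𝔐`** (`K(𝔐) ≤ K(𝔑v^{n+1})` by the monotonicity of ray class fields, then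
II.1.10 for the reading modulus `𝔑`). [cite: deShalit1987, II §1.10 Lemma (p. 39), II §4.5 (p. 58)] -/
theorem absClosureEmbedding_mem_sup_ltField_of_le (h𝔑 : 𝔑 ≠ ⊥) (hv : ¬ 𝔑 ≤ v.asIdeal)
    {π : 𝒪[v.adicCompletion K]} (hπ : (valuation (v.adicCompletion K)).IsUniformizer (π : v.adicCompletion K))
    {α : 𝓞 K} (hα0 : α ≠ 0) (hα𝔑 : α - 1 ∈ 𝔑) (hαw : ∀ w : HeightOneSpectrum (𝓞 K), w ≠ v → α ∉ w.asIdeal)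
    {f : ℕ} (hαπ : ((α : K) : v.adicCompletion K) = (π : v.adicCompletion K) ^ f)
    (E : IntermediateField (v.adicCompletion K) (AlgebraicClosure (v.adicCompletion K)))
    [FiniteDimensional (v.adicCompletion K) E] [Normal (v.adicCompletion K) E]
    (hdegE : ∀ w : WeilGroup (v.adicCompletion K),
      WeilGroup.toAbsGalois (v.adicCompletion K) w ∈ E.fixingSubgroup → (f : ℤ) ∣ WeilGroup.deg w)
    (n : ℕ) {𝔐 : Ideal (𝓞 K)} (hle : 𝔑 * v.asIdeal ^ (n + 1) ≤ 𝔐) {x : AlgebraicClosure K} (hx : x ∈ rayClassField K 𝔐) :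
    absClosureEmbedding K (v.adicCompletion K) x ∈
      (E ⊔ ltField π n : IntermediateField (v.adicCompletion K) (AlgebraicClosure (v.adicCompletion K))) :=
  absClosureEmbedding_mem_sup_ltField_of_mem_rayClassField_mul_pow h𝔑 hv hπ hα0 hα𝔑 hαw hαπ E hdegE n
    (rayClassField_mono (rayUnitIdeles_anti_of_le (mul_ne_zero h𝔑 (pow_ne_zero _ v.ne_bot)) hle) hx)

open ValuativeRel in
/-- ★★ **One reading**: for `z ∈ 𝔠⁻¹L ∖ L` and a reading modulus `𝔑` with `𝔑·v^{n+1} ≤ 𝔣ψ·𝔠` there are `x, y ∈ K̄` with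
`ι̂ x = ℘(z) − b₂/12`, `ι̂ y = (℘′(z) − a₁(℘(z) − b₂/12) − a₃)/2` and elements `X, Y ∈ E·K_π^{n+1}` with `↑X = e x`, `↑Y = e y`
(`e = absClosureEmbedding K K_v`). [cite: deShalit1987, II §1.5 (15), II §1.10, II §4.4–4.5 (p. 57–58)] -/
theorem exists_reading
    (h6 : ∀ 𝔠 : Ideal (𝓞 K), 𝔠 ≠ ⊥ → ∀ z : ℂ, z ∈ idealInvLattice ι 𝔠 L.lattice → z ∉ L.lattice →
      ∃ x y : rayClassField K (𝔣ψ * 𝔠), algClosureEmb ι x = ℘[L] z ∧ algClosureEmb ι y = ℘'[L] z)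
    {𝔠 : Ideal (𝓞 K)} (h𝔠 : 𝔠 ≠ ⊥) {z : ℂ} (hz : z ∈ idealInvLattice ι 𝔠 L.lattice) (hzL : z ∉ L.lattice)
    (h𝔑 : 𝔑 ≠ ⊥) (hv : ¬ 𝔑 ≤ v.asIdeal)
    {π : 𝒪[v.adicCompletion K]} (hπ : (valuation (v.adicCompletion K)).IsUniformizer (π : v.adicCompletion K))
    {α : 𝓞 K} (hα0 : α ≠ 0) (hα𝔑 : α - 1 ∈ 𝔑) (hαw : ∀ w : HeightOneSpectrum (𝓞 K), w ≠ v → α ∉ w.asIdeal)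
    {f : ℕ} (hαπ : ((α : K) : v.adicCompletion K) = (π : v.adicCompletion K) ^ f)
    (E : IntermediateField (v.adicCompletion K) (AlgebraicClosure (v.adicCompletion K)))
    [FiniteDimensional (v.adicCompletion K) E] [Normal (v.adicCompletion K) E]
    (hdegE : ∀ w : WeilGroup (v.adicCompletion K),
      WeilGroup.toAbsGalois (v.adicCompletion K) w ∈ E.fixingSubgroup → (f : ℤ) ∣ WeilGroup.deg w)
    (n : ℕ) (hle : 𝔑 * v.asIdeal ^ (n + 1) ≤ 𝔣ψ * 𝔠) :
    ∃ (x y : AlgebraicClosure K)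
      (X Y : ↥(E ⊔ ltField π n : IntermediateField (v.adicCompletion K) (AlgebraicClosure (v.adicCompletion K)))),
      algClosureEmb ι x = ℘[L] z - (W.baseChange ℂ).b₂ / 12 ∧
      algClosureEmb ι y = (℘'[L] z - (W.baseChange ℂ).a₁ * (℘[L] z - (W.baseChange ℂ).b₂ / 12) - (W.baseChange ℂ).a₃) / 2 ∧
      ((X : ↥(E ⊔ ltField π n : IntermediateField (v.adicCompletion K) (AlgebraicClosure (v.adicCompletion K)))) :
          AlgebraicClosure (v.adicCompletion K)) = (absClosureEmbedding K (v.adicCompletion K)).toRingHom x ∧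
      ((Y : ↥(E ⊔ ltField π n : IntermediateField (v.adicCompletion K) (AlgebraicClosure (v.adicCompletion K)))) :
          AlgebraicClosure (v.adicCompletion K)) = (absClosureEmbedding K (v.adicCompletion K)).toRingHom y := by
  obtain ⟨x, y, hxF, hyF, hx, hy⟩ := exists_model_coords_mem_rayClassField ι L W h6 h𝔠 hz hzL
  exact ⟨x, y, ⟨_, absClosureEmbedding_mem_sup_ltField_of_le h𝔑 hv hπ hα0 hα𝔑 hαw hαπ E hdegE n hle hxF⟩,
    ⟨_, absClosureEmbedding_mem_sup_ltField_of_le h𝔑 hv hπ hα0 hα𝔑 hαw hαπ E hdegE n hle hyF⟩, hx, hy, rfl, rfl⟩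

/-! ## §3 The division points of the model lattice `L = Ω·ι(𝔪)` lie in `(𝔪v^k)⁻¹L` -/

variable {𝔪 : Ideal (𝓞 K)} {Ω : ℂ} {π₀ β : 𝓞 K}

omit [NumberField K] [IsTotallyComplex K] in
/-- **`ι(π₀^k)·z = Ω·ι(c)` with `c ∈ 𝒪_K` ⇒ `z ∈ (𝔪v^k)⁻¹L`** for `L = Ω·ι(𝔪)`, `v = (π₀)`. [cite: deShalit1987, II §4.2 (6), II §4.4] -/
theorem mem_idealInvLattice_mul_pow_of_eq (hL : ∀ z : ℂ, z ∈ L.lattice ↔ ∃ a ∈ 𝔪, z = Ω * ι (a : K))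
    (hv0 : v.asIdeal = Ideal.span {π₀}) {z : ℂ} {k : ℕ} {c : 𝓞 K} (h : ι ((π₀ ^ k : 𝓞 K) : K) * z = Ω * ι (c : K)) :
    z ∈ idealInvLattice ι (𝔪 * v.asIdeal ^ k) L.lattice := by
  rw [mem_idealInvLattice_iff]
  intro a ha
  rw [hv0, Ideal.span_singleton_pow, mul_comm, Ideal.mem_span_singleton_mul] at ha
  obtain ⟨b, hb, rfl⟩ := ha
  refine (hL _).mpr ⟨b * c, 𝔪.mul_mem_right _ hb, ?_⟩
  have e : ι (((π₀ ^ k * b : 𝓞 K)) : K) * z = ι (b : K) * (ι ((π₀ ^ k : 𝓞 K) : K) * z) := by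
    push_cast
    rw [map_mul]
    ring
  rw [e, h]
  push_cast
  rw [map_mul]
  ring

omit [NumberField K] [IsTotallyComplex K] in
/-- **`u_k = ι(β^k)Ω − Ω/ι(π₀^k) ∈ (𝔪v^k)⁻¹L`** (`ι(π₀^k)u_k = Ω·ι((βπ₀)^k − 1)`, B-lat). [cite: deShalit1987, II §4.4 (iv)] -/
theorem divisionPt_mem_idealInvLattice (hL : ∀ z : ℂ, z ∈ L.lattice ↔ ∃ a ∈ 𝔪, z = Ω * ι (a : K))
    (hv0 : v.asIdeal = Ideal.span {π₀}) (hπ₀ : π₀ ≠ 0) (k : ℕ) :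
    ι ((β ^ k : 𝓞 K) : K) * Ω - Ω / ι ((π₀ ^ k : 𝓞 K) : K) ∈ idealInvLattice ι (𝔪 * v.asIdeal ^ k) L.lattice :=
  mem_idealInvLattice_mul_pow_of_eq ι L hL hv0 (pow_mul_divisionPt_eq ι hπ₀ β k)

omit [NumberField K] [IsTotallyComplex K] in
/-- **`Ω/ι(π₀^k) ∈ (𝔪v^k)⁻¹L`** (`ι(π₀^k)·(Ω/ι(π₀^k)) = Ω·ι(1)`). [cite: deShalit1987, II §4.9 (23)] -/
theorem div_mem_idealInvLattice (hL : ∀ z : ℂ, z ∈ L.lattice ↔ ∃ a ∈ 𝔪, z = Ω * ι (a : K))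
    (hv0 : v.asIdeal = Ideal.span {π₀}) (hπ₀ : π₀ ≠ 0) (k : ℕ) :
    Ω / ι ((π₀ ^ k : 𝓞 K) : K) ∈ idealInvLattice ι (𝔪 * v.asIdeal ^ k) L.lattice := by
  refine mem_idealInvLattice_mul_pow_of_eq ι L hL hv0 (c := 1) ?_
  have h0 : ι ((π₀ ^ k : 𝓞 K) : K) ≠ 0 := (map_ne_zero ι).mpr (by exact_mod_cast pow_ne_zero k hπ₀)
  rw [mul_div_cancel₀ _ h0]
  simp

omit [IsTotallyComplex K] in
/-- **`Ω + u_k ∈ (𝔪v^k)⁻¹L`** (`ι(π₀^k)(Ω + u_k) = Ω·ι(π₀^k + (βπ₀)^k − 1)`). [cite: deShalit1987, II §4.4 (iv), II §4.9] -/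
theorem add_divisionPt_mem_idealInvLattice (hL : ∀ z : ℂ, z ∈ L.lattice ↔ ∃ a ∈ 𝔪, z = Ω * ι (a : K))
    (hv0 : v.asIdeal = Ideal.span {π₀}) (hπ₀ : π₀ ≠ 0) (k : ℕ) :
    Ω + (ι ((β ^ k : 𝓞 K) : K) * Ω - Ω / ι ((π₀ ^ k : 𝓞 K) : K)) ∈ idealInvLattice ι (𝔪 * v.asIdeal ^ k) L.lattice := by
  refine mem_idealInvLattice_mul_pow_of_eq ι L hL hv0 (c := π₀ ^ k + ((β * π₀) ^ k - 1)) ?_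
  rw [mul_add, pow_mul_divisionPt_eq ι hπ₀ β k]
  push_cast
  simp only [map_add, map_sub, map_mul, map_pow, map_one]
  ring

omit [IsTotallyComplex K] in
/-- **`ι(π₀)(Ω + u_k) ∈ (𝔪v^k)⁻¹L`** (`(𝔪v^k)⁻¹L` is `𝒪_K`-stable). [cite: deShalit1987, II §4.4 (iv), II §4.9] -/
theorem mul_add_divisionPt_mem_idealInvLattice (hL : ∀ z : ℂ, z ∈ L.lattice ↔ ∃ a ∈ 𝔪, z = Ω * ι (a : K))
    (hv0 : v.asIdeal = Ideal.span {π₀}) (hπ₀ : π₀ ≠ 0) (k : ℕ) :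
    ι (π₀ : K) * (Ω + (ι ((β ^ k : 𝓞 K) : K) * Ω - Ω / ι ((π₀ ^ k : 𝓞 K) : K))) ∈
      idealInvLattice ι (𝔪 * v.asIdeal ^ k) L.lattice := by
  refine mem_idealInvLattice_mul_pow_of_eq ι L hL hv0 (c := π₀ * (π₀ ^ k + ((β * π₀) ^ k - 1))) ?_
  rw [mul_left_comm, mul_add, pow_mul_divisionPt_eq ι hπ₀ β k]
  push_cast
  simp only [map_add, map_sub, map_mul, map_pow, map_one]
  ring

omit [NumberField K] [IsTotallyComplex K] in
/-- **`Ω/ι(π₀^k) ∉ L`** (else `Ω = ι(π₀^k)·(Ω/ι(π₀^k)) ∈ L`, but `Ω ∉ L` as `𝔪 ≠ 𝒪_K`). [cite: deShalit1987, II §4.2 (6), II §4.9 (23)] -/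
theorem div_pow_notMem (hL : ∀ z : ℂ, z ∈ L.lattice ↔ ∃ a ∈ 𝔪, z = Ω * ι (a : K)) (hΩ : Ω ≠ 0) (h𝔪 : 𝔪 ≠ ⊤)
    (hπ₀ : π₀ ≠ 0) (k : ℕ) : Ω / ι ((π₀ ^ k : 𝓞 K) : K) ∉ L.lattice := by
  intro h
  have h0 : ι ((π₀ ^ k : 𝓞 K) : K) ≠ 0 := (map_ne_zero ι).mpr (by exact_mod_cast pow_ne_zero k hπ₀)
  have h1 := isCMLattice_of_model ι hL (π₀ ^ k) _ h
  rw [mul_div_cancel₀ _ h0] at h1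
  exact notMem_lattice_of_model ι hL hΩ h𝔪 h1

/-! ## §4 The sixteen-object reading block of the per-unit bridge (B10f-b/c/d) -/

open ValuativeRel in
/-- ★★★ **READINGS for the per-unit bridge**: the levelwise model coordinates of `ξ(u_{m+1})`, `ξ(Ω/π₀^{m+1})` (read in `E·K_π^{m+1}`)
and of `ξ(Ω + u_{m+2})`, `ξ(π₀(Ω + u_{m+2}))` (read in `E·K_π^{m+2}`) as elements of `K̄` with their sixteen reading equations —
EXACTLY the binder block `xu yu xq yq xw yw xz yz hxu … hyz XU YU XQ YQ XW YW XZ YZ hXU … hYZ` of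
`KatzMeasureJZeroSeam.exists_unit_relColemanSeries_eq_subst_subst_of_thetaReadings` — for the model lattice `L = Ω·ι(𝔪)`, the split
prime `v = (π₀)`, `2 = π₀π₁` (`π₀` prime, `π₀ ∤ π₁`, `π₀^k ∉ 𝔪`), `βπ₀ ≡ 1 (𝔪)`, and a reading modulus `𝔑 ≤ 𝔣ψ·𝔪` (`v ∤ 𝔑`) whose
`α`-datum the unramified base `E` satisfies.  (II.1.5 (15) + II.1.10 + II.4.4 (iv).)
[cite: deShalit1987, II §1.5 (15), II §1.10, II §4.4 (iv), II §4.9 (23)] -/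
theorem exists_divisionPt_readings
    (h6 : ∀ 𝔠 : Ideal (𝓞 K), 𝔠 ≠ ⊥ → ∀ z : ℂ, z ∈ idealInvLattice ι 𝔠 L.lattice → z ∉ L.lattice →
      ∃ x y : rayClassField K (𝔣ψ * 𝔠), algClosureEmb ι x = ℘[L] z ∧ algClosureEmb ι y = ℘'[L] z)
    (hL : ∀ z : ℂ, z ∈ L.lattice ↔ ∃ a ∈ 𝔪, z = Ω * ι (a : K)) (hΩ : Ω ≠ 0)
    {π₁ : 𝓞 K} (hv0 : v.asIdeal = Ideal.span {π₀}) (h2K : (2 : 𝓞 K) = π₀ * π₁) (hprime : Prime π₀) (hπ₁ : ¬ π₀ ∣ π₁)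
    (hπ₀𝔪 : ∀ k : ℕ, (π₀ ^ k : 𝓞 K) ∉ 𝔪) (hβ : β * π₀ - 1 ∈ 𝔪)
    -- the reading modulus and the local frame
    (h𝔑 : 𝔑 ≠ ⊥) (hv : ¬ 𝔑 ≤ v.asIdeal) (h𝔑ψ : 𝔑 ≤ 𝔣ψ * 𝔪)
    {π : 𝒪[v.adicCompletion K]} (hπ : (valuation (v.adicCompletion K)).IsUniformizer (π : v.adicCompletion K))
    {α : 𝓞 K} (hα0 : α ≠ 0) (hα𝔑 : α - 1 ∈ 𝔑) (hαw : ∀ w : HeightOneSpectrum (𝓞 K), w ≠ v → α ∉ w.asIdeal)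
    {f : ℕ} (hαπ : ((α : K) : v.adicCompletion K) = (π : v.adicCompletion K) ^ f)
    (E : IntermediateField (v.adicCompletion K) (AlgebraicClosure (v.adicCompletion K)))
    [FiniteDimensional (v.adicCompletion K) E] [Normal (v.adicCompletion K) E]
    (hdegE : ∀ w : WeilGroup (v.adicCompletion K),
      WeilGroup.toAbsGalois (v.adicCompletion K) w ∈ E.fixingSubgroup → (f : ℤ) ∣ WeilGroup.deg w) :
    ∃ (xu yu xq yq xw yw xz yz : ℕ → AlgebraicClosure K)
      (XU YU XQ YQ : ∀ m : ℕ, ↥(E ⊔ ltField π m : IntermediateField (v.adicCompletion K) (AlgebraicClosure (v.adicCompletion K))))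
      (XW YW XZ YZ : ∀ m : ℕ, ↥(E ⊔ ltField π (m + 1) : IntermediateField (v.adicCompletion K) (AlgebraicClosure (v.adicCompletion K)))),
      (∀ m : ℕ, algClosureEmb ι (xu m) =
        ℘[L] (ι ((β ^ (m + 1) : 𝓞 K) : K) * Ω - Ω / ι ((π₀ ^ (m + 1) : 𝓞 K) : K)) - (W.baseChange ℂ).b₂ / 12) ∧
      (∀ m : ℕ, algClosureEmb ι (yu m) = (℘'[L] (ι ((β ^ (m + 1) : 𝓞 K) : K) * Ω - Ω / ι ((π₀ ^ (m + 1) : 𝓞 K) : K)) -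
        (W.baseChange ℂ).a₁ * (℘[L] (ι ((β ^ (m + 1) : 𝓞 K) : K) * Ω - Ω / ι ((π₀ ^ (m + 1) : 𝓞 K) : K)) - (W.baseChange ℂ).b₂ / 12) -
        (W.baseChange ℂ).a₃) / 2) ∧
      (∀ m : ℕ, algClosureEmb ι (xq m) = ℘[L] (Ω / ι ((π₀ ^ (m + 1) : 𝓞 K) : K)) - (W.baseChange ℂ).b₂ / 12) ∧
      (∀ m : ℕ, algClosureEmb ι (yq m) = (℘'[L] (Ω / ι ((π₀ ^ (m + 1) : 𝓞 K) : K)) -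
        (W.baseChange ℂ).a₁ * (℘[L] (Ω / ι ((π₀ ^ (m + 1) : 𝓞 K) : K)) - (W.baseChange ℂ).b₂ / 12) - (W.baseChange ℂ).a₃) / 2) ∧
      (∀ m : ℕ, algClosureEmb ι (xw m) =
        ℘[L] (Ω + (ι ((β ^ (m + 2) : 𝓞 K) : K) * Ω - Ω / ι ((π₀ ^ (m + 2) : 𝓞 K) : K))) - (W.baseChange ℂ).b₂ / 12) ∧
      (∀ m : ℕ, algClosureEmb ι (yw m) = (℘'[L] (Ω + (ι ((β ^ (m + 2) : 𝓞 K) : K) * Ω - Ω / ι ((π₀ ^ (m + 2) : 𝓞 K) : K))) -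
        (W.baseChange ℂ).a₁ * (℘[L] (Ω + (ι ((β ^ (m + 2) : 𝓞 K) : K) * Ω - Ω / ι ((π₀ ^ (m + 2) : 𝓞 K) : K))) -
          (W.baseChange ℂ).b₂ / 12) - (W.baseChange ℂ).a₃) / 2) ∧
      (∀ m : ℕ, algClosureEmb ι (xz m) =
        ℘[L] (ι (π₀ : K) * (Ω + (ι ((β ^ (m + 2) : 𝓞 K) : K) * Ω - Ω / ι ((π₀ ^ (m + 2) : 𝓞 K) : K)))) - (W.baseChange ℂ).b₂ / 12) ∧
      (∀ m : ℕ, algClosureEmb ι (yz m) =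
        (℘'[L] (ι (π₀ : K) * (Ω + (ι ((β ^ (m + 2) : 𝓞 K) : K) * Ω - Ω / ι ((π₀ ^ (m + 2) : 𝓞 K) : K)))) -
          (W.baseChange ℂ).a₁ * (℘[L] (ι (π₀ : K) * (Ω + (ι ((β ^ (m + 2) : 𝓞 K) : K) * Ω - Ω / ι ((π₀ ^ (m + 2) : 𝓞 K) : K)))) -
            (W.baseChange ℂ).b₂ / 12) - (W.baseChange ℂ).a₃) / 2) ∧
      (∀ m, ((XU m : ↥(E ⊔ ltField π m : IntermediateField (v.adicCompletion K) (AlgebraicClosure (v.adicCompletion K)))) :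
          AlgebraicClosure (v.adicCompletion K)) = (absClosureEmbedding K (v.adicCompletion K)).toRingHom (xu m)) ∧
      (∀ m, ((YU m : ↥(E ⊔ ltField π m : IntermediateField (v.adicCompletion K) (AlgebraicClosure (v.adicCompletion K)))) :
          AlgebraicClosure (v.adicCompletion K)) = (absClosureEmbedding K (v.adicCompletion K)).toRingHom (yu m)) ∧
      (∀ m, ((XQ m : ↥(E ⊔ ltField π m : IntermediateField (v.adicCompletion K) (AlgebraicClosure (v.adicCompletion K)))) :
          AlgebraicClosure (v.adicCompletion K)) = (absClosureEmbedding K (v.adicCompletion K)).toRingHom (xq m)) ∧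
      (∀ m, ((YQ m : ↥(E ⊔ ltField π m : IntermediateField (v.adicCompletion K) (AlgebraicClosure (v.adicCompletion K)))) :
          AlgebraicClosure (v.adicCompletion K)) = (absClosureEmbedding K (v.adicCompletion K)).toRingHom (yq m)) ∧
      (∀ m, ((XW m : ↥(E ⊔ ltField π (m + 1) : IntermediateField (v.adicCompletion K) (AlgebraicClosure (v.adicCompletion K)))) :
          AlgebraicClosure (v.adicCompletion K)) = (absClosureEmbedding K (v.adicCompletion K)).toRingHom (xw m)) ∧
      (∀ m, ((YW m : ↥(E ⊔ ltField π (m + 1) : IntermediateField (v.adicCompletion K) (AlgebraicClosure (v.adicCompletion K)))) :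
          AlgebraicClosure (v.adicCompletion K)) = (absClosureEmbedding K (v.adicCompletion K)).toRingHom (yw m)) ∧
      (∀ m, ((XZ m : ↥(E ⊔ ltField π (m + 1) : IntermediateField (v.adicCompletion K) (AlgebraicClosure (v.adicCompletion K)))) :
          AlgebraicClosure (v.adicCompletion K)) = (absClosureEmbedding K (v.adicCompletion K)).toRingHom (xz m)) ∧
      (∀ m, ((YZ m : ↥(E ⊔ ltField π (m + 1) : IntermediateField (v.adicCompletion K) (AlgebraicClosure (v.adicCompletion K)))) :
          AlgebraicClosure (v.adicCompletion K)) = (absClosureEmbedding K (v.adicCompletion K)).toRingHom (yz m)) := by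
  have hπ₀ : π₀ ≠ 0 := hprime.ne_zero
  have h𝔪 : 𝔪 ≠ ⊤ := fun h => hπ₀𝔪 0 (by rw [h]; exact Submodule.mem_top)
  have h𝔪0 : 𝔪 ≠ ⊥ := by
    rintro rfl
    obtain ⟨a, ha, h⟩ := (hL _).mp L.ω₁_mem_lattice
    rw [Ideal.mem_bot] at ha
    rw [ha] at h
    simp only [map_zero, mul_zero] at h
    exact L.ω₁_div_two_notMem_lattice (by rw [h, zero_div]; exact L.lattice.zero_mem)
  have hne : ∀ k : ℕ, 𝔪 * v.asIdeal ^ k ≠ ⊥ := fun k => mul_ne_zero h𝔪0 (pow_ne_zero _ v.ne_bot)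
  have hle : ∀ k : ℕ, 𝔑 * v.asIdeal ^ k ≤ 𝔣ψ * (𝔪 * v.asIdeal ^ k) := fun k => by
    rw [← mul_assoc]; exact Ideal.mul_mono_left h𝔑ψ
  -- the four readings, levelwise
  have Ru : ∀ m : ℕ, _ := fun m => exists_reading ι L W h6 (hne (m + 1))
    (divisionPt_mem_idealInvLattice ι L (β := β) hL hv0 hπ₀ (m + 1)) (divisionPt_succ_notMem ι hL hΩ h2K hprime hπ₁ m)
    h𝔑 hv hπ hα0 hα𝔑 hαw hαπ E hdegE m (hle (m + 1))
  have Rq : ∀ m : ℕ, _ := fun m => exists_reading ι L W h6 (hne (m + 1))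
    (div_mem_idealInvLattice ι L hL hv0 hπ₀ (m + 1)) (div_pow_notMem ι L hL hΩ h𝔪 hπ₀ (m + 1))
    h𝔑 hv hπ hα0 hα𝔑 hαw hαπ E hdegE m (hle (m + 1))
  have Rw : ∀ m : ℕ, _ := fun m => exists_reading ι L W h6 (hne (m + 2))
    (add_divisionPt_mem_idealInvLattice ι L (β := β) hL hv0 hπ₀ (m + 2)) (add_divisionPt_notMem ι hL hΩ hβ hπ₀ (hπ₀𝔪 (m + 2)))
    h𝔑 hv hπ hα0 hα𝔑 hαw hαπ E hdegE (m + 1) (hle (m + 2))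
  have Rz : ∀ m : ℕ, _ := fun m => exists_reading ι L W h6 (hne (m + 2))
    (mul_add_divisionPt_mem_idealInvLattice ι L (β := β) hL hv0 hπ₀ (m + 2))
    (mul_add_divisionPt_succ_notMem ι hL hΩ hβ hπ₀ (hπ₀𝔪 (m + 2)))
    h𝔑 hv hπ hα0 hα𝔑 hαw hαπ E hdegE (m + 1) (hle (m + 2))
  choose xu yu XU YU hxu hyu hXU hYU using Ru
  choose xq yq XQ YQ hxq hyq hXQ hYQ using Rq
  choose xw yw XW YW hxw hyw hXW hYW using Rw
  choose xz yz XZ YZ hxz hyz hXZ hYZ using Rz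
  exact ⟨xu, yu, xq, yq, xw, yw, xz, yz, XU, YU, XQ, YQ, XW, YW, XZ, YZ, hxu, hyu, hxq, hyq, hxw, hyw, hxz, hyz,
    hXU, hYU, hXQ, hYQ, hXW, hYW, hXZ, hYZ⟩


end DivisionPointReadings

end Literature.NumberTheory.EllipticCurves

end
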